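import Mathlib
import Summits.KontsevichZagierPeriods.Zeta5Search.Families.DualRateDictionary
import Summits.KontsevichZagierPeriods.Zeta5Search.Families.CoeffAsympLimit
import Summits.KontsevichZagierPeriods.Zeta5Search.Families.CoeffAsympInf
import HarnessLib

/-!
# ζ(5) search — Families: CONJECTURE D on the genuine cone, II — the identification of the dual growth constant and
# the limit theorem

HONEST FRAMING: systematic search; no irrationality claim unless certified.  Cell `pub-zeta5`, certifier 2
(cert-2 g9, 2026-08-22).  Real analysis; nothing about the arithmetic of `ζ(5)`; no number of record moves; no
conjecture node is used as a hypothesis.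

* **`raySup_dual_eq_inv_iInf`** — for `a` with `bzNum a, bzDen a ≥ 0` and `dualConstantTerm a ≠ 0`:
  `raySup(₈π₈; bzDen a, bzNum a) = (inf_u Λ_a(e^u))⁻¹` (the dual ray function is `1/Λ_a(gaps)`, `Λ_a` is scale
  invariant and bounded below by `dualConstantTerm a ≥ 1`);
* **`leadingCoeffRate_of_ct_ne_zero`** — `log|Q(n·a)|/n → −log raySup(₈π₈; bzDen a, bzNum a)` for every such `a`
  — P2's CONJECTURE D (`Families/DualConstantTerm.LeadingCoeffRateIsDualDecay`) on the part of the cone where the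
  leading coefficient does not vanish (cert-2 g8's D-exact + the coefficient asymptotics `Families/CoeffAsymp*`).
Standard axioms only.
-/

noncomputable section

open MvPolynomial Finset Real Filter Topology

namespace Summit.KontsevichZagierPeriods.Zeta5Search.Families.Cellular

open Literature.NumberTheory.Irrationality CoeffAsymp DualCT

namespace DualRate

/-! ## The dual growth constant is the reciprocal of `inf Λ_a` -/

/-- `Λ_a(gaps t) ≥ dualConstantTerm a` on the simplex and `Λ_a(e^u)` is the abstract tilt. -/
theorem tilt_ge_ct (a : Fin 8 → ℤ) (u : Fin 6 → ℝ) :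
    (dualConstantTerm a : ℝ) ≤ tilt (realPoly a).support (fun m => coeff m (realPoly a)) (baseExp a) u := by
  rw [tilt_support_eq]
  exact dualConstantTerm_le_lam a fun w => Real.exp_pos _

/-- **`raySup(₈π₈; bzDen a, bzNum a) = (inf_u Λ_a(e^u))⁻¹`** for `a` on the cone with `dualConstantTerm a ≠ 0`. -/
theorem raySup_dual_eq_inv_iInf {a : Fin 8 → ℤ} (hA : ∀ i, 0 ≤ bzNum a i) (hB : ∀ i, 0 ≤ bzDen a i)
    (hct : dualConstantTerm a ≠ 0) :
    raySup pi8dualInv (bzDen a) (bzNum a) =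
      (⨅ u : Fin 6 → ℝ, tilt (realPoly a).support (fun m => coeff m (realPoly a)) (baseExp a) u)⁻¹ := by
  set T : (Fin 6 → ℝ) → ℝ := fun u => tilt (realPoly a).support (fun m => coeff m (realPoly a)) (baseExp a) u with hT
  -- the constant term is a positive integer
  have hct_pos : (0 : ℝ) < dualConstantTerm a := by
    have h0 : (0 : ℤ) ≤ dualConstantTerm a := by
      have := dualConstantTerm_eq_coeff a
      exact_mod_cast (this ▸ coeff_realPoly_nonneg a (baseExp a) : (0 : ℝ) ≤ (dualConstantTerm a : ℝ))
    exact_mod_cast lt_of_le_of_ne h0 (Ne.symm hct)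
  have hTge : ∀ u, (dualConstantTerm a : ℝ) ≤ T u := fun u => tilt_ge_ct a u
  have hM : (dualConstantTerm a : ℝ) ≤ ⨅ u, T u := le_ciInf hTge
  have hMpos : 0 < ⨅ u, T u := lt_of_lt_of_le hct_pos hM
  have hbdd : BddBelow (Set.range T) := ⟨_, by rintro _ ⟨u, rfl⟩; exact hTge u⟩
  -- `rayF t = 1/Λ(gaps t) = 1/T(log gaps)`
  have hray : ∀ t ∈ openSimplex 5, rayF pi8dualInv (bzDen a) (bzNum a) t = (T fun w => Real.log (gap t w))⁻¹ := by
    intro t ht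
    rw [rayF_dual_eq_inv hA hB, hT]
    simp only
    rw [tilt_support_eq]
    congr 2
    funext w
    rw [Real.exp_log (gap_pos ht w)]
  unfold raySup
  refine csSup_eq_of_forall_le_of_forall_lt_exists_gt ((openSimplex_nonempty 5).image _) ?_ ?_
  · rintro _ ⟨t, ht, rfl⟩
    rw [hray t ht]
    exact inv_anti₀ hMpos (ciInf_le hbdd _)
  · intro w hw
    by_cases hw0 : w ≤ 0
    · obtain ⟨t, ht⟩ := openSimplex_nonempty 5
      exact ⟨_, ⟨t, ht, rfl⟩, lt_of_le_of_lt hw0 (rayF_pos pi8dualInv (bzDen a) (bzNum a) pi8dualInv_injective' ht)⟩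
    · have hw0' : 0 < w := lt_of_not_ge hw0
      have hlt : ⨅ u, T u < w⁻¹ := (lt_inv_comm₀ hw0' hMpos).1 hw
      obtain ⟨u, hu⟩ := exists_lt_of_ciInf_lt hlt
      set g : Fin 6 → ℝ := fun i => Real.exp (u i) with hg
      have hgpos : ∀ i, 0 < g i := fun i => Real.exp_pos _
      have hs : 0 < gsum g := gsum_pos hgpos
      refine ⟨_, ⟨simplexPoint g, simplexPoint_mem hgpos, rfl⟩, ?_⟩
      rw [rayF_dual_eq_inv hA hB]
      have hgap : gap (simplexPoint g) = fun i => (gsum g)⁻¹ * g i := funext (gap_simplexPoint hgpos)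
      have hlamT : lam a g = T u := by rw [hT]; simp only [hg]; rw [tilt_support_eq]
      rw [hgap, lam_smul hA hB (inv_pos.2 hs) g, hlamT]
      exact (lt_inv_comm₀ hw0' (lt_of_lt_of_le hct_pos (hTge u))).2 hu

/-! ## CONJECTURE D on the genuine cone -/

/-- **P2's CONJECTURE D for every `a` on the cone with non-vanishing leading coefficient**:
`log|Q(n·a)|/n → −log raySup(₈π₈; bzDen a, bzNum a)`. -/
theorem leadingCoeffRate_of_ct_ne_zero {a : Fin 8 → ℤ} (hA : ∀ i, 0 ≤ bzNum a i) (hB : ∀ i, 0 ≤ bzDen a i)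
    (hct : dualConstantTerm a ≠ 0) :
    Tendsto (fun n : ℕ => Real.log |(BrownZudilin2022.QOf (fun i => (n : ℤ) * a i) : ℝ)| / n) atTop
      (𝓝 (-Real.log (raySup pi8dualInv (bzDen a) (bzNum a)))) := by
  set S := (realPoly a).support with hS
  set c : (Fin 6 →₀ ℕ) → ℝ := fun m => coeff m (realPoly a) with hc_def
  have hc : ∀ m ∈ S, 0 < c m := coeff_realPoly_pos a
  have hBS : baseExp a ∈ S := baseExp_mem_support hct
  obtain ⟨u₀, hmin⟩ := exists_tilt_face_min hc hBS
  have hlim := tendsto_log_coeff_div hc hBS hmin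
  have hpoly : poly S c = realPoly a := (realPoly_eq_poly a).symm
  rw [hpoly] at hlim
  -- the two sequences agree
  have hseq : (fun n : ℕ => Real.log |(BrownZudilin2022.QOf (fun i => (n : ℤ) * a i) : ℝ)| / n) =
      fun n : ℕ => Real.log (coeff (n • baseExp a) (realPoly a ^ n)) / n := by
    funext n
    have hA' : ∀ i, 0 ≤ bzNum (fun i => (n : ℤ) * a i) i := by
      intro i; rw [bzNum_smul]; exact mul_nonneg (by positivity) (hA i)
    have hB' : ∀ i, 0 ≤ bzDen (fun i => (n : ℤ) * a i) i := by
      intro i; rw [bzDen_smul]; exact mul_nonneg (by positivity) (hB i)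
    have h1 : |(BrownZudilin2022.QOf (fun i => (n : ℤ) * a i) : ℝ)| =
        (dualConstantTerm (fun i => (n : ℤ) * a i) : ℝ) := by
      rw [← Int.cast_abs, DualR.dexact_cone _ hA' hB']
    rw [h1, dualConstantTerm_ray_eq_coeff hA hB n]
  rw [hseq]
  -- the two limits agree
  have hval : Real.log (tilt (face S (baseExp a)) c (baseExp a) u₀) =
      -Real.log (raySup pi8dualInv (bzDen a) (bzNum a)) := by
    rw [raySup_dual_eq_inv_iInf hA hB hct, Real.log_inv, neg_neg, ← hS, ← hc_def, iInf_tilt_eq_tilt_face_min hc hmin]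
  rw [← hval]
  exact hlim

end DualRate

end Summit.KontsevichZagierPeriods.Zeta5Search.Families.Cellular
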